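import Summits.HubbardSuperconductivity.HubbardSuperconductivity.Theorems.BalabanIRBirComplexStableXYRStubActionConjNeg
import Summits.HubbardSuperconductivity.HubbardSuperconductivity.Theorems.BalabanIRBirComplexStableXYRSmoothedBoxPartition
import Literature.MathematicalPhysics.QuantumFieldTheory.TorusChartCochains
import HarnessLib

/-!
# Crux `BirComplexStableXYR` (stmt-HubbardSuperconductivity-14845), line `fat-gaussian-defect-calculus`, chapter 2:
# stub B2b `stub_sectorConjugation` — conjugation pairs the vortex sectors

Registered stub (lead c7, wave 6; skeleton `Cruxes/BirComplexStableXYR/Lines/fat_gaussian_defect_calculus.lean`), helper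
(`--supports`) for the crux `Summit.HubbardSuperconductivity.HubbardSuperconductivity.Theses.BalabanIR.BirComplexStableXYR`.

**Statement.** On the engine's torus `Λ L M = (ℤ/L)² × ℤ/M` with its space–time chart `F = TorusChart.piProdZMod 2 L M`,
for a window table `c` with (R) time-reflection Hermiticity and (P) spatial-inversion evenness, every real `K`, every
variance `v`, every observable `O` and every integer `1`-cochain `a`, the complex conjugate of the pinned sector integral
`T(O, a) = ∫_{φ 0 ∈ [0,2π)} O(φ) e^{−A(φ)} W_v(d₀φ − 2πa) dφ` (with the smoothed-box bond weight
`W_v(η) = Π_{x,i} χ_v(η(x,i))`, `χ_v(s) = ∫_{[-π,π]} g_v(s − t) dt`) is the pinned sector integral of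
`conj (O (φ ∘ neg)) · e^{−A(φ)} · W_v(d₀φ − 2πa^J)` with the reflected gauge field `a^J(y,i) = −a(−y − e_i, i)`.

**Proof.** (1) `conj ∫ = ∫ conj` (`integral_conj`).  (2) Pointwise, `conj (O e^{−A} W) = conj O · e^{−conj A} · W`
(`W` is real) and `conj A(φ) = A(φ ∘ neg)` by the landed stub B2a `stub_actionConjNeg` ((R) ∧ (P)).  (3) The site
inversion `ρ φ = φ ∘ neg` is a volume-preserving coordinate permutation of `ℝ^Λ`
(`volume_measurePreserving_piCongrLeft`) fixing the pinning condition `φ 0 ∈ [0,2π)`, so `∫_S G(ρ φ) dφ = ∫_S G(φ) dφ`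
(`MeasurePreserving.setIntegral_preimage_emb`).  (4) `d₀(φ ∘ neg)(x,i) = −d₀φ(−x − e_i, i)`; the smoothed box is even
(`t ↦ −t` on the symmetric interval and evenness of the centred Gaussian), and `x ↦ −x − e_i` is a bijection of the
sites, whence `W_v(d₀(ρφ) − 2πa^J) = W_v(d₀φ − 2πa)`.  Elementary; no definition is introduced; sorry-free.
[folklore: Fröhlich–Spencer, CMP 81 (1981) §3, charge conjugation of the vortex-sector decomposition]
-/

set_option linter.dupNamespace false -- `Summit.<S>.<S>.Theorems…` repeats the summit name (D-0017 layout)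

noncomputable section

namespace Summit.HubbardSuperconductivity.HubbardSuperconductivity.Theorems.FSUnfolding

open scoped BigOperators ComplexConjugate
open MeasureTheory Literature.MathematicalPhysics.QuantumFieldTheory Literature.Probability.LatticeModels
open Summit.HubbardSuperconductivity.BirComplexStableXYNegative

/-- The centred Gaussian density is even. [folklore] -/
theorem gaussianPDFReal_zero_neg (v : NNReal) (x : ℝ) :
    ProbabilityTheory.gaussianPDFReal 0 v (-x) = ProbabilityTheory.gaussianPDFReal 0 v x := by
  simp only [ProbabilityTheory.gaussianPDFReal, sub_zero, neg_sq]

/-- **Evenness of the smoothed box** `χ_v(s) = ∫_{[-π,π]} g_v(s − t) dt`: `χ_v(−s) = χ_v(s)` (substitute `t ↦ −t`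
on the symmetric interval and use the evenness of the centred Gaussian). [folklore] -/
theorem smoothedBox_even (v : NNReal) (s : ℝ) :
    (∫ t in Set.Icc (-Real.pi) Real.pi, ProbabilityTheory.gaussianPDFReal 0 v (-s - t)) =
      ∫ t in Set.Icc (-Real.pi) Real.pi, ProbabilityTheory.gaussianPDFReal 0 v (s - t) := by
  have hπ : -Real.pi ≤ Real.pi := by linarith [Real.pi_pos]
  calc (∫ t in Set.Icc (-Real.pi) Real.pi, ProbabilityTheory.gaussianPDFReal 0 v (-s - t))
      = ∫ t in (-Real.pi)..Real.pi, ProbabilityTheory.gaussianPDFReal 0 v (-s - t) := by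
        rw [intervalIntegral.integral_of_le hπ, integral_Icc_eq_integral_Ioc]
    _ = ∫ u in (-s - Real.pi)..(-s - -Real.pi), ProbabilityTheory.gaussianPDFReal 0 v u :=
        intervalIntegral.integral_comp_sub_left (ProbabilityTheory.gaussianPDFReal 0 v) (-s)
    _ = ∫ u in (-s - Real.pi)..(-s - -Real.pi), ProbabilityTheory.gaussianPDFReal 0 v (-u) := by
        simp only [gaussianPDFReal_zero_neg]
    _ = ∫ u in (-(-s - -Real.pi))..(-(-s - Real.pi)), ProbabilityTheory.gaussianPDFReal 0 v u :=
        intervalIntegral.integral_comp_neg (ProbabilityTheory.gaussianPDFReal 0 v)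
    _ = ∫ u in (s - Real.pi)..(s - -Real.pi), ProbabilityTheory.gaussianPDFReal 0 v u := by
        congr 1 <;> ring
    _ = ∫ t in (-Real.pi)..Real.pi, ProbabilityTheory.gaussianPDFReal 0 v (s - t) :=
        (intervalIntegral.integral_comp_sub_left (ProbabilityTheory.gaussianPDFReal 0 v) s).symm
    _ = ∫ t in Set.Icc (-Real.pi) Real.pi, ProbabilityTheory.gaussianPDFReal 0 v (s - t) := by
        rw [intervalIntegral.integral_of_le hπ, integral_Icc_eq_integral_Ioc]

/-- **The site inversion preserves the pinned integral.**  On the fields of the engine's torus the coordinate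
permutation `φ ↦ φ ∘ neg` preserves Lebesgue measure (`volume_measurePreserving_piCongrLeft`) and the pinning
condition `φ 0 ∈ [0,2π)` (`−0 = 0`), so `∫_{φ 0 ∈ [0,2π)} f (φ ∘ neg) dφ = ∫_{φ 0 ∈ [0,2π)} f φ dφ` for every `f`
(`MeasurePreserving.setIntegral_preimage_emb`). [folklore] -/
theorem setIntegral_pinned_comp_neg (L M : ℕ) [NeZero L] [NeZero M] (f : (Λ L M → ℝ) → ℂ) :
    (∫ φ in {φ : Λ L M → ℝ | φ 0 ∈ Set.Ico 0 (2 * Real.pi)}, f (fun y => φ (-y))) =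
      ∫ φ in {φ : Λ L M → ℝ | φ 0 ∈ Set.Ico 0 (2 * Real.pi)}, f φ := by
  set e : (Λ L M → ℝ) ≃ᵐ (Λ L M → ℝ) :=
    (MeasurableEquiv.piCongrLeft (fun _ : Λ L M => ℝ) (Equiv.neg (Λ L M))).symm with he
  have hmp : MeasurePreserving e volume volume :=
    (volume_measurePreserving_piCongrLeft (fun _ : Λ L M => ℝ) (Equiv.neg (Λ L M))).symm _
  have happ : ∀ φ : Λ L M → ℝ, e φ = fun y => φ (-y) := fun φ => rfl
  have hpre : e ⁻¹' {φ : Λ L M → ℝ | φ 0 ∈ Set.Ico 0 (2 * Real.pi)} =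
      {φ : Λ L M → ℝ | φ 0 ∈ Set.Ico 0 (2 * Real.pi)} := by
    ext φ
    simp only [Set.mem_preimage, Set.mem_setOf_eq, happ, neg_zero]
  have h := hmp.setIntegral_preimage_emb e.measurableEmbedding f
    {φ : Λ L M → ℝ | φ 0 ∈ Set.Ico 0 (2 * Real.pi)}
  rw [hpre] at h
  simpa only [happ] using h

/-- **The bond weight of the inverted field is the bond weight of the reflected gauge field.**  For an even
single-bond weight `w` and the space–time chart `F = TorusChart.piProdZMod 2 L M`:
`Π_{x,i} w(d₀(φ ∘ neg)(x,i) − 2π a^J(x,i)) = Π_{x,i} w(d₀φ(x,i) − 2π a(x,i))` with `a^J(x,i) = −a(−x − e_i, i)`, because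
`d₀(φ ∘ neg)(x,i) = −d₀φ(−x − e_i, i)` and `x ↦ −x − e_i` is a bijection of the sites for each direction `i`.
[folklore] -/
theorem bondWeight_comp_neg {β : Type*} [CommMonoid β] (L M : ℕ) [NeZero L] [NeZero M]
    (w : ℝ → β) (hw : ∀ s, w (-s) = w s) (φ : Λ L M → ℝ) (a : Λ L M → Fin 3 → ℤ) :
    (∏ x : Λ L M, ∏ i : Fin 3, w ((TorusChart.piProdZMod 2 L M).d₀ (fun y => φ (-y)) x i
        - 2 * Real.pi * ((-a (-x - (TorusChart.piProdZMod 2 L M).gen i) i : ℤ) : ℝ))) =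
      ∏ x : Λ L M, ∏ i : Fin 3,
        w ((TorusChart.piProdZMod 2 L M).d₀ φ x i - 2 * Real.pi * (a x i : ℝ)) := by
  rw [Finset.prod_comm]
  conv_rhs => rw [Finset.prod_comm]
  refine Finset.prod_congr rfl (fun i _ => ?_)
  symm
  refine Fintype.prod_equiv ((Equiv.neg (Λ L M)).trans
    (Equiv.subRight ((TorusChart.piProdZMod 2 L M).gen i))) _ _ (fun y => ?_)
  simp only [Equiv.trans_apply, Equiv.neg_apply, Equiv.subRight_apply, TorusChart.d₀_apply]
  have e1 : -(-y - (TorusChart.piProdZMod 2 L M).gen i + (TorusChart.piProdZMod 2 L M).gen i) = y := by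
    abel
  have e2 : -(-y - (TorusChart.piProdZMod 2 L M).gen i) - (TorusChart.piProdZMod 2 L M).gen i = y := by
    abel
  have e3 : -(-y - (TorusChart.piProdZMod 2 L M).gen i) = y + (TorusChart.piProdZMod 2 L M).gen i := by
    abel
  rw [e1, e2, e3, ← hw]
  congr 1
  push_cast
  ring

/-- **Sector conjugation, abstract form.**  For any "action" `A` conjugated by the site inversion
(`A (φ ∘ neg) = conj (A φ)`), any observable `O`, any even single-bond weight `g` and any integer `1`-cochain `a`:
`conj ∫_{φ 0 ∈ [0,2π)} O e^{−A} Π g(d₀φ − 2πa) = ∫_{φ 0 ∈ [0,2π)} conj (O ∘ neg^*) e^{−A} Π g(d₀φ − 2πa^J)`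
(`integral_conj`, the pointwise conjugation, the substitution `φ ↦ φ ∘ neg` of `setIntegral_pinned_comp_neg`, and
`bondWeight_comp_neg`). [folklore] -/
theorem sectorConj_core (L M : ℕ) [NeZero L] [NeZero M] (A O : (Λ L M → ℝ) → ℂ)
    (hA : ∀ θ : Λ L M → ℝ, A (fun y => θ (-y)) = conj (A θ))
    (g : ℝ → ℝ) (hg : ∀ s, g (-s) = g s) (a : Λ L M → Fin 3 → ℤ) :
    conj (∫ φ in {φ : Λ L M → ℝ | φ 0 ∈ Set.Ico 0 (2 * Real.pi)},
        O φ * Complex.exp (-(A φ)) *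
          ∏ x : Λ L M, ∏ i : Fin 3,
            ((g ((TorusChart.piProdZMod 2 L M).d₀ φ x i - 2 * Real.pi * (a x i : ℝ)) : ℝ) : ℂ)) =
      ∫ φ in {φ : Λ L M → ℝ | φ 0 ∈ Set.Ico 0 (2 * Real.pi)},
        conj (O (fun y => φ (-y))) * Complex.exp (-(A φ)) *
          ∏ x : Λ L M, ∏ i : Fin 3, ((g ((TorusChart.piProdZMod 2 L M).d₀ φ x i
            - 2 * Real.pi * ((-a (-x - (TorusChart.piProdZMod 2 L M).gen i) i : ℤ) : ℝ)) : ℝ) : ℂ) := by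
  -- pointwise conjugation of the integrand, written as a function of the inverted field `φ ∘ neg`
  have hpt : ∀ φ : Λ L M → ℝ,
      conj (O φ * Complex.exp (-(A φ)) *
          ∏ x : Λ L M, ∏ i : Fin 3,
            ((g ((TorusChart.piProdZMod 2 L M).d₀ φ x i - 2 * Real.pi * (a x i : ℝ)) : ℝ) : ℂ)) =
        conj (O (fun y => φ (-(-y)))) * Complex.exp (-(A (fun y => φ (-y)))) *
          ∏ x : Λ L M, ∏ i : Fin 3, ((g ((TorusChart.piProdZMod 2 L M).d₀ (fun y => φ (-y)) x i
            - 2 * Real.pi * ((-a (-x - (TorusChart.piProdZMod 2 L M).gen i) i : ℤ) : ℝ)) : ℝ) : ℂ) := by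
    intro φ
    have hφ : (fun y : Λ L M => φ (-(-y))) = φ := funext fun y => by rw [neg_neg]
    rw [hφ, map_mul, map_mul, ← Complex.exp_conj, map_neg, ← hA φ,
      bondWeight_comp_neg L M (fun s => ((g s : ℝ) : ℂ)) (fun s => by rw [hg]) φ a]
    congr 1
    simp only [map_prod, Complex.conj_ofReal]
  rw [← integral_conj]
  refine (integral_congr_ae (ae_of_all _ hpt)).trans ?_
  exact setIntegral_pinned_comp_neg L M (fun χ => conj (O (fun y => χ (-y))) * Complex.exp (-(A χ)) *
    ∏ x : Λ L M, ∏ i : Fin 3, ((g ((TorusChart.piProdZMod 2 L M).d₀ χ x i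
      - 2 * Real.pi * ((-a (-x - (TorusChart.piProdZMod 2 L M).gen i) i : ℤ) : ℝ)) : ℝ) : ℂ))

/-- **Stub B2b `stub_sectorConjugation` (registered signature, verbatim): conjugation pairs the sectors.**  Under
(R)∧(P) the complex conjugate of the pinned sector integral of `O·e^{−A}·W_v(d₀φ − 2πa)` is the pinned sector integral
of `conj(O∘neg)·e^{−A}·W_v(d₀φ − 2πa^J)` with the reflected gauge field `a^J(y,i) = −a(−y − e_i, i)`
(`stub_actionConjNeg`, the substitution `φ ↦ φ∘neg` — a volume-preserving coordinate permutation fixing the pinning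
`φ 0 ∈ [0,2π)` —, `d₀(φ∘neg)(x,i) = −d₀φ(−x−e_i,i)`, evenness and reality of the smoothed box).  With B1/B4: sector
`(q,h)` is paired with a sector of opposite holonomy and reflected vorticity, term ↦ conj term — the reality of the
holonomy theta series and the input of `conjPositivity_endgame` at the level of the representation. [folklore] -/
theorem stub_sectorConjugation :
    ∀ (r : ℕ) (K : ℝ) (c : Table r),
      (∀ n : Freq r, c (fun w => n (w.1, w.2.1, Fin.rev w.2.2)) = (starRingEnd ℂ) (c (-n))) →
      (∀ n : Freq r, c (fun w => n (Fin.rev w.1, Fin.rev w.2.1, w.2.2)) = c n) →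
      ∀ (L M : ℕ) [NeZero L] [NeZero M] (v : NNReal) (O : (Λ L M → ℝ) → ℂ) (a : Λ L M → Fin 3 → ℤ),
        (starRingEnd ℂ) (∫ φ in {φ : Λ L M → ℝ | φ 0 ∈ Set.Ico 0 (2 * Real.pi)},
          O φ * Complex.exp (-(action K c L M φ)) *
            ∏ x : Λ L M, ∏ i : Fin 3, ((∫ t in Set.Icc (-Real.pi) Real.pi, ProbabilityTheory.gaussianPDFReal 0 v
              ((TorusChart.piProdZMod 2 L M).d₀ φ x i - 2 * Real.pi * (a x i : ℝ) - t) : ℝ) : ℂ)) =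
        ∫ φ in {φ : Λ L M → ℝ | φ 0 ∈ Set.Ico 0 (2 * Real.pi)},
          (starRingEnd ℂ) (O (fun y => φ (-y))) * Complex.exp (-(action K c L M φ)) *
            ∏ x : Λ L M, ∏ i : Fin 3, ((∫ t in Set.Icc (-Real.pi) Real.pi, ProbabilityTheory.gaussianPDFReal 0 v
              ((TorusChart.piProdZMod 2 L M).d₀ φ x i
                - 2 * Real.pi * ((-a (-x - (TorusChart.piProdZMod 2 L M).gen i) i : ℤ) : ℝ) - t) : ℝ) : ℂ) := by
  intro r K c hR hP L M _ _ v O a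
  exact sectorConj_core L M (action K c L M) O (stub_actionConjNeg r K c hR hP L M)
    (fun s => ∫ t in Set.Icc (-Real.pi) Real.pi, ProbabilityTheory.gaussianPDFReal 0 v (s - t))
    (smoothedBox_even v) a

end Summit.HubbardSuperconductivity.HubbardSuperconductivity.Theorems.FSUnfolding

end
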